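import Literature.Probability.RandomPlanarGeometry.SmoothArcLocal
import Mathlib.Analysis.Convex.Segment
import HarnessLib

/-!
# Steps of the smooth hit path construction: moving off the boundary arc inside the hull

Two geometric steps for `IsSmoothHullWith.exists_smoothHitPath` (`SmoothHitPathExists`), in the
tangential/normal coordinates `T(z) = re((z - z₀) v̄)`, `N(z) = im((z - z₀) v̄)` at a regular
boundary point `z₀ = γ s₀`, `v = γ' s₀` (`SmoothArcLocal`):

* `subset_interior_of_disjoint_arc` — a preconnected subset of `ℍ` missing the boundary arc
  `γ[0,1]` of the hull `A` and meeting `int A` lies in `int A`;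
* `exists_vertical_step` — from a point `w` near `z₀` off the arc, the segment in the normal
  direction `± i v` up to normal height `± 2h‖v‖` (away from the at most one arc point on the
  normal line through `w`) misses the arc and stays in `B(z₀, 3h)`;
* `coord_add_mul_I_mul` and friends — the coordinate computations along normal lines.

All folklore.
-/

noncomputable section

open Set Filter Metric Complex Function
open _root_.Topology
open UpperHalfPlane (upperHalfPlaneSet isOpen_upperHalfPlaneSet)
open scoped unitInterval ComplexConjugate

namespace Literature.Probability.RandomPlanarGeometry

/-! ### Coordinates along normal lines -/

/-- `v v̄ = ‖v‖²`. [folklore] -/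
theorem mul_conj_eq_norm_sq (v : ℂ) : v * conj v = ((‖v‖ ^ 2 : ℝ) : ℂ) := by
  rw [Complex.mul_conj, Complex.normSq_eq_norm_sq]

/-- Moving by `t i v` changes the coordinates `(T, N)` by `(0, t ‖v‖²)`. [folklore] -/
theorem coord_add_mul_I_mul (w z₀ v : ℂ) (t : ℝ) :
    (w + (t : ℂ) * (Complex.I * v) - z₀) * conj v = (w - z₀) * conj v + ((t * ‖v‖ ^ 2 : ℝ) : ℂ) * Complex.I := by
  have h := mul_conj_eq_norm_sq v
  calc (w + (t : ℂ) * (Complex.I * v) - z₀) * conj v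
      = (w - z₀) * conj v + (t : ℂ) * Complex.I * (v * conj v) := by ring
    _ = (w - z₀) * conj v + ((t * ‖v‖ ^ 2 : ℝ) : ℂ) * Complex.I := by rw [h]; push_cast; ring

/-- The tangential coordinate is unchanged along a normal line. [folklore] -/
theorem re_coord_add_mul_I_mul (w z₀ v : ℂ) (t : ℝ) :
    ((w + (t : ℂ) * (Complex.I * v) - z₀) * conj v).re = ((w - z₀) * conj v).re := by
  rw [coord_add_mul_I_mul]
  simp only [Complex.add_re, Complex.mul_re, Complex.ofReal_re, Complex.ofReal_im, Complex.I_re, Complex.I_im]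
  ring

/-- The normal coordinate changes by `t ‖v‖²` along a normal line. [folklore] -/
theorem im_coord_add_mul_I_mul (w z₀ v : ℂ) (t : ℝ) :
    ((w + (t : ℂ) * (Complex.I * v) - z₀) * conj v).im = ((w - z₀) * conj v).im + t * ‖v‖ ^ 2 := by
  rw [coord_add_mul_I_mul]
  simp only [Complex.add_im, Complex.mul_im, Complex.ofReal_re, Complex.ofReal_im, Complex.I_re, Complex.I_im]
  ring

/-- Norm control by the coordinates: `‖z - z₀‖ ‖v‖ ≤ |T z| + |N z|`. [folklore] -/
theorem norm_mul_le_abs_coord (z z₀ v : ℂ) :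
    ‖z - z₀‖ * ‖v‖ ≤ |((z - z₀) * conj v).re| + |((z - z₀) * conj v).im| := by
  rw [← Complex.norm_conj v, ← norm_mul]
  exact Complex.norm_le_abs_re_add_abs_im _

/-- Two points with the same coordinates coincide (`v ≠ 0`). [folklore] -/
theorem eq_of_coord_eq {z z' z₀ v : ℂ} (hv : v ≠ 0) (h : (z - z₀) * conj v = (z' - z₀) * conj v) : z = z' := by
  have hcv : conj v ≠ 0 := (map_ne_zero _).2 hv
  have := mul_right_cancel₀ hcv h
  exact sub_left_injective this

/-! ### Connected sets off the boundary arc -/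

/-- **A preconnected subset of `ℍ` missing the boundary arc and meeting the interior lies in the
interior** of the hull (its points are interior or exterior, two disjoint open conditions).
[folklore] -/
theorem subset_interior_of_disjoint_arc {A : Set ℂ} {γ : ℝ → ℂ}
    (hfrA : upperHalfPlaneSet ∩ frontier A = γ '' Ioo 0 1) {P : Set ℂ} (hPc : IsPreconnected P)
    (hPH : P ⊆ upperHalfPlaneSet) (hPγ : Disjoint P (γ '' Icc 0 1)) (hPint : (P ∩ interior A).Nonempty) :
    P ⊆ interior A := by
  have hPfr : Disjoint P (frontier A) := by
    rw [Set.disjoint_left]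
    intro z hz hzfr
    have : z ∈ upperHalfPlaneSet ∩ frontier A := ⟨hPH hz, hzfr⟩
    rw [hfrA] at this
    obtain ⟨s, hs, rfl⟩ := this
    exact Set.disjoint_left.1 hPγ hz ⟨s, Ioo_subset_Icc_self hs, rfl⟩
  have hcover : P ⊆ interior A ∪ (closure A)ᶜ := fun z hz ↦ by
    by_cases hzcl : z ∈ closure A
    · rw [closure_eq_interior_union_frontier] at hzcl
      rcases hzcl with h | h
      · exact Or.inl h
      · exact absurd h (Set.disjoint_left.1 hPfr hz)
    · exact Or.inr hzcl
  have hdisj : Disjoint (interior A) (closure A)ᶜ :=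
    Set.disjoint_left.2 fun z hz hzc ↦ hzc (interior_subset_closure hz)
  rcases hPc.subset_or_subset isOpen_interior isClosed_closure.isOpen_compl hdisj hcover with h | h
  · exact h
  · obtain ⟨z, hzP, hzint⟩ := hPint
    exact absurd (interior_subset_closure hzint) (h hzP)

/-! ### The vertical step -/

/-- **The vertical step.** Let `w ∉ γ[0,1]` have coordinates `|T w|, |N w| < h ‖v‖` at `z₀`
with respect to `v ≠ 0`; suppose arc points within `3h` of `z₀` have parameters in the window
`|s - s₀| < κ`, on which the tangential coordinate of `γ` is injective. Then for `sg = 1` or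
`sg = -1` the point `w₁ = w + t₁ i v` with `T w₁ = T w`, `N w₁ = 2sgh‖v‖` is joined to `w` by a
segment inside `B(z₀, 3h)` missing `γ[0,1]`. [folklore] -/
theorem exists_vertical_step {γ : ℝ → ℂ} {z₀ v w : ℂ} (hv : v ≠ 0) {s₀ κ h : ℝ}
    (hnear : ∀ s ∈ Icc (0 : ℝ) 1, ‖γ s - z₀‖ < 3 * h → |s - s₀| < κ)
    (huniq : ∀ s ∈ Icc (0 : ℝ) 1, ∀ s' ∈ Icc (0 : ℝ) 1, |s - s₀| < κ → |s' - s₀| < κ →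
      ((γ s - z₀) * conj v).re = ((γ s' - z₀) * conj v).re → s = s')
    (hwγ : w ∉ γ '' Icc 0 1) (hTw : |((w - z₀) * conj v).re| < h * ‖v‖) (hNw : |((w - z₀) * conj v).im| < h * ‖v‖) :
    ∃ sg : ℝ, (sg = 1 ∨ sg = -1) ∧ ∃ w₁ : ℂ, ((w₁ - z₀) * conj v).re = ((w - z₀) * conj v).re ∧
      ((w₁ - z₀) * conj v).im = sg * (2 * h * ‖v‖) ∧ segment ℝ w w₁ ⊆ ball z₀ (3 * h) ∧
      Disjoint (segment ℝ w w₁) (γ '' Icc 0 1) := by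
  set a : ℝ := ((w - z₀) * conj v).re with ha
  set b : ℝ := ((w - z₀) * conj v).im with hb
  have hν : 0 < ‖v‖ := norm_pos_iff.2 hv
  have hν2 : 0 < ‖v‖ ^ 2 := by positivity
  have hb' := abs_lt.1 hNw
  -- the points `z(t) = w + t i v` and their coordinates
  set z : ℝ → ℂ := fun t ↦ w + (t : ℂ) * (Complex.I * v) with hz
  have hzT : ∀ t, ((z t - z₀) * conj v).re = a := fun t ↦ re_coord_add_mul_I_mul w z₀ v t
  have hzN : ∀ t, ((z t - z₀) * conj v).im = b + t * ‖v‖ ^ 2 := fun t ↦ im_coord_add_mul_I_mul w z₀ v t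
  -- points with `|N| ≤ 2h‖v‖` on this line are in `B(z₀, 3h)`
  have hball : ∀ t, |b + t * ‖v‖ ^ 2| ≤ 2 * h * ‖v‖ → z t ∈ ball z₀ (3 * h) := by
    intro t ht
    rw [mem_ball, dist_eq_norm]
    have h1 := norm_mul_le_abs_coord (z t) z₀ v
    rw [hzT, hzN] at h1
    have h2 : ‖z t - z₀‖ * ‖v‖ < 3 * h * ‖v‖ := by linarith
    exact lt_of_mul_lt_mul_right h2 hν.le
  -- the segment from `w = z 0` to `z t₁`
  have hseg : ∀ t₁ : ℝ, segment ℝ w (z t₁) = (fun θ : ℝ ↦ z (θ * t₁)) '' Icc 0 1 := by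
    intro t₁
    rw [segment_eq_image']
    refine image_congr fun θ _ ↦ ?_
    simp only [hz]
    rw [Complex.real_smul]; push_cast; ring
  -- arc points on the line `T = a` near `z₀`
  by_cases hex : ∃ s ∈ Icc (0 : ℝ) 1, |s - s₀| < κ ∧ ((γ s - z₀) * conj v).re = a ∧ b ≤ ((γ s - z₀) * conj v).im
  · -- go down
    obtain ⟨s₁, hs₁, hs₁κ, hs₁T, hs₁N⟩ := hex
    have hs₁N' : b < ((γ s₁ - z₀) * conj v).im := by
      rcases hs₁N.eq_or_lt with heq | hlt
      · exfalso
        have hpt : γ s₁ = w :=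
          eq_of_coord_eq (z := γ s₁) (z' := w) (z₀ := z₀) hv (Complex.ext (by rw [hs₁T]) heq.symm)
        exact hwγ ⟨s₁, hs₁, hpt⟩
      · exact hlt
    set t₁ : ℝ := -((b + 2 * h * ‖v‖) / ‖v‖ ^ 2) with ht₁
    have ht₁N : b + t₁ * ‖v‖ ^ 2 = -(2 * h * ‖v‖) := by rw [ht₁]; field_simp; ring
    refine ⟨-1, Or.inr rfl, z t₁, hzT t₁, by rw [hzN, ht₁N]; ring, ?_, ?_⟩
    · rw [hseg t₁]
      rintro _ ⟨θ, hθ, rfl⟩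
      refine hball _ (abs_le.2 ⟨?_, ?_⟩)
      · have : b + θ * t₁ * ‖v‖ ^ 2 = b - θ * (b + 2 * h * ‖v‖) := by rw [ht₁]; field_simp; ring
        rw [this]; nlinarith [hθ.1, hθ.2, hb'.1, hb'.2]
      · have : b + θ * t₁ * ‖v‖ ^ 2 = b - θ * (b + 2 * h * ‖v‖) := by rw [ht₁]; field_simp; ring
        rw [this]; nlinarith [hθ.1, hθ.2, hb'.1, hb'.2]
    · rw [hseg t₁, Set.disjoint_left]
      rintro _ ⟨θ, hθ, rfl⟩ ⟨s, hs, hse⟩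
      have hzt_ball : z (θ * t₁) ∈ ball z₀ (3 * h) := by
        refine hball _ (abs_le.2 ⟨?_, ?_⟩)
        · have : b + θ * t₁ * ‖v‖ ^ 2 = b - θ * (b + 2 * h * ‖v‖) := by rw [ht₁]; field_simp; ring
          rw [this]; nlinarith [hθ.1, hθ.2, hb'.1, hb'.2]
        · have : b + θ * t₁ * ‖v‖ ^ 2 = b - θ * (b + 2 * h * ‖v‖) := by rw [ht₁]; field_simp; ring
          rw [this]; nlinarith [hθ.1, hθ.2, hb'.1, hb'.2]
      have hsκ : |s - s₀| < κ := hnear s hs (by rw [show γ s = z (θ * t₁) from hse, ← dist_eq_norm]; exact hzt_ball)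
      have hsT : ((γ s - z₀) * conj v).re = a := by rw [show γ s = z (θ * t₁) from hse, hzT]
      have hss₁ : s = s₁ := huniq s hs s₁ hs₁ hsκ hs₁κ (by rw [hsT, hs₁T])
      have hN := hzN (θ * t₁)
      have hse' : γ s = z (θ * t₁) := hse
      rw [← hse', hss₁] at hN
      have : b + θ * t₁ * ‖v‖ ^ 2 = b - θ * (b + 2 * h * ‖v‖) := by rw [ht₁]; field_simp; ring
      rw [this] at hN
      nlinarith [hθ.1, hb'.1, hs₁N']
  · -- go up
    push Not at hex
    set t₁ : ℝ := (2 * h * ‖v‖ - b) / ‖v‖ ^ 2 with ht₁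
    have ht₁N : b + t₁ * ‖v‖ ^ 2 = 2 * h * ‖v‖ := by rw [ht₁]; field_simp; ring
    refine ⟨1, Or.inl rfl, z t₁, hzT t₁, by rw [hzN, ht₁N]; ring, ?_, ?_⟩
    · rw [hseg t₁]
      rintro _ ⟨θ, hθ, rfl⟩
      refine hball _ (abs_le.2 ⟨?_, ?_⟩)
      · have : b + θ * t₁ * ‖v‖ ^ 2 = b + θ * (2 * h * ‖v‖ - b) := by rw [ht₁]; field_simp
        rw [this]; nlinarith [hθ.1, hθ.2, hb'.1, hb'.2]
      · have : b + θ * t₁ * ‖v‖ ^ 2 = b + θ * (2 * h * ‖v‖ - b) := by rw [ht₁]; field_simp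
        rw [this]; nlinarith [hθ.1, hθ.2, hb'.1, hb'.2]
    · rw [hseg t₁, Set.disjoint_left]
      rintro _ ⟨θ, hθ, rfl⟩ ⟨s, hs, hse⟩
      have hzt_ball : z (θ * t₁) ∈ ball z₀ (3 * h) := by
        refine hball _ (abs_le.2 ⟨?_, ?_⟩)
        · have : b + θ * t₁ * ‖v‖ ^ 2 = b + θ * (2 * h * ‖v‖ - b) := by rw [ht₁]; field_simp
          rw [this]; nlinarith [hθ.1, hθ.2, hb'.1, hb'.2]
        · have : b + θ * t₁ * ‖v‖ ^ 2 = b + θ * (2 * h * ‖v‖ - b) := by rw [ht₁]; field_simp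
          rw [this]; nlinarith [hθ.1, hθ.2, hb'.1, hb'.2]
      have hsκ : |s - s₀| < κ := hnear s hs (by rw [show γ s = z (θ * t₁) from hse, ← dist_eq_norm]; exact hzt_ball)
      have hsT : ((γ s - z₀) * conj v).re = a := by rw [show γ s = z (θ * t₁) from hse, hzT]
      have hN := hzN (θ * t₁)
      have hse' : γ s = z (θ * t₁) := hse
      rw [← hse'] at hN
      have : b + θ * t₁ * ‖v‖ ^ 2 = b + θ * (2 * h * ‖v‖ - b) := by rw [ht₁]; field_simp
      rw [this] at hN
      have hge : b ≤ ((γ s - z₀) * conj v).im := by rw [hN]; nlinarith [hθ.1, hb'.2]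
      exact absurd hge (not_le.2 (hex s hs hsκ hsT))

end Literature.Probability.RandomPlanarGeometry
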